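import Literature.Analysis.FluidPDE.TorusNSGevreyLattice
import HarnessLib

/-!
# Weighted Young `ℓ¹ ⋆ ℓ¹ ⊂ ℓ¹` on `ℤ^d`: Wiener algebras with a submultiplicative weight (Gevrey–Wiener, Lei–Lin)

Topic `Literature/Analysis/FunctionSpaces`.  The lattice convolution `(α ⋆ β)(k) = ∑_l α(k−l) β(l)` of two
nonnegative families on `ℤ^d` satisfies, for every SUBMULTIPLICATIVE weight `w(k) ≤ w(k−l) w(l)`,

  `∑_k w(k) (α ⋆ β)(k) ≤ (∑_k w(k) α(k)) · (∑_l w(l) β(l))`   (`Lattice.tsum_weight_mul_conv_le`),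

i.e. the weighted `ℓ¹` space is a Banach algebra under convolution — on the Fourier side: the Wiener
algebra `A(𝕋^d)` (`w ≡ 1`), the analytic Gevrey–Wiener classes `∑_k e^{ψ|k|}‖û(k)‖ < ∞` (`w = e^{ψ|k|}`,
submultiplicative by the triangle inequality `|k| ≤ |k−l| + |l|`: `NSGevrey.exp_mul_sqrt_freqNormSq_le_mul`,
the un-truncated form of the tree's `NSGevrey.exp_mul_min_le_mul`), and the polynomially weighted algebras
`(1+|k|)^s`, `s ≥ 0`.  Everything in `[0, ∞]` (unconditional sums, no summability bookkeeping), as in the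
tree's `Lattice.young_sq` (`ℓ¹ ⋆ ℓ² ⊂ ℓ²`, `LatticeConvolution.lean`) and `NSGevrey.sum_mul_tsum_mul_le`.

* `Lattice.tsum_weight_mul_conv_le` — the weighted Young inequality above;
* `Lattice.tsum_conv_le` — the unweighted case `∑_k (α ⋆ β)(k) ≤ (∑ α)(∑ β)` (in fact an equality; the
  inequality is what is used);
* `NSGevrey.exp_mul_sqrt_freqNormSq_le_mul` — `e^{ψ|k|} ≤ e^{ψ|k−l|} e^{ψ|l|}` for `ψ ≥ 0`;
* `NSGevrey.tsum_exp_mul_conv_le` — the Gevrey–Wiener algebra inequality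
  `∑_k e^{ψ|k|} (α ⋆ β)(k) ≤ (∑_k e^{ψ|k|} α(k)) (∑_l e^{ψ|l|} β(l))`.

Theorems only; no definitions, no named facts.

## References
* [Katznelson2004] Y. Katznelson, *An Introduction to Harmonic Analysis*, 3rd ed., CUP 2004, Ch. I §6
  (the Wiener algebra `A(𝕋)`: absolutely convergent Fourier series form a Banach algebra,
  `‖fg‖_{A} ≤ ‖f‖_{A}‖g‖_{A}`), and Ch. VIII (Banach algebras with weights).
* [FoiasTemam1989] C. Foias, R. Temam, J. Funct. Anal. 87 (1989) 359–369, Lemma 2.1 (the Gevrey weight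
  `e^{ψ|k|}` is submultiplicative under `k = j + l`).
-/

noncomputable section

open scoped ENNReal

namespace Literature.Analysis.FunctionSpaces

namespace Lattice

variable {d : Type*}

/-- **Weighted Young inequality `ℓ¹ ⋆ ℓ¹ ⊂ ℓ¹` on `ℤ^d`** for a submultiplicative weight
(`w(k) ≤ w(k−l)·w(l)` for all `k, l`), `[0,∞]`-valued and unconditional:
`∑_k w(k) ∑_l α(k−l) β(l) ≤ (∑_k w(k) α(k)) · (∑_l w(l) β(l))` — the weighted `ℓ¹` space is a Banach
algebra under lattice convolution (Katznelson, Ch. I §6 for `w ≡ 1`; weighted: Ch. VIII).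
[cite: Katznelson2004, Ch. I §6; Ch. VIII] -/
theorem tsum_weight_mul_conv_le (w α β : (d → ℤ) → ℝ≥0∞) (hw : ∀ k l, w k ≤ w (k - l) * w l) :
    ∑' k, w k * ∑' l, α (k - l) * β l ≤ (∑' k, w k * α k) * ∑' l, w l * β l := by
  calc ∑' k, w k * ∑' l, α (k - l) * β l
      = ∑' k, ∑' l, w k * (α (k - l) * β l) := by
        simp_rw [ENNReal.tsum_mul_left]
    _ ≤ ∑' k, ∑' l, (w (k - l) * α (k - l)) * (w l * β l) := by
        refine ENNReal.tsum_le_tsum fun k => ENNReal.tsum_le_tsum fun l => ?_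
        calc w k * (α (k - l) * β l) ≤ (w (k - l) * w l) * (α (k - l) * β l) :=
              mul_le_mul' (hw k l) le_rfl
          _ = (w (k - l) * α (k - l)) * (w l * β l) := by ring
    _ = ∑' l, ∑' k, (w (k - l) * α (k - l)) * (w l * β l) := ENNReal.tsum_comm
    _ = ∑' l, (∑' k, w (k - l) * α (k - l)) * (w l * β l) := by
        simp_rw [ENNReal.tsum_mul_right]
    _ = ∑' l, (∑' k, w k * α k) * (w l * β l) := by
        refine tsum_congr fun l => ?_
        rw [show (∑' k, w (k - l) * α (k - l)) = ∑' k, w k * α k from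
          (Equiv.subRight l).tsum_eq (fun k => w k * α k)]
    _ = (∑' k, w k * α k) * ∑' l, w l * β l := by
        rw [ENNReal.tsum_mul_left]

/-- **Young `ℓ¹ ⋆ ℓ¹ ⊂ ℓ¹` on `ℤ^d`** (unweighted, `[0,∞]`-valued): `∑_k ∑_l α(k−l) β(l) ≤ (∑ α)(∑ β)`
(the Wiener algebra `A(𝕋^d)` under pointwise products). [cite: Katznelson2004, Ch. I §6] -/
theorem tsum_conv_le (α β : (d → ℤ) → ℝ≥0∞) :
    ∑' k, ∑' l, α (k - l) * β l ≤ (∑' k, α k) * ∑' l, β l := by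
  have h := tsum_weight_mul_conv_le (fun _ => (1 : ℝ≥0∞)) α β (fun _ _ => by simp)
  simpa only [one_mul] using h

end Lattice

end Literature.Analysis.FunctionSpaces

namespace Literature.Analysis.FluidPDE

namespace NSGevrey

open Literature.Analysis.FunctionSpaces Torus

variable {d : Type*} [Fintype d]

/-- **Submultiplicativity of the (un-truncated) Gevrey weight**: for `ψ ≥ 0`,
`e^{ψ|k|} ≤ e^{ψ|k−l|} · e^{ψ|l|}` (`|k| = √(freqNormSq k)`; triangle inequality `|k| ≤ |k−l| + |l|`,
the tree's `sqrt_freqNormSq_add_le`). Foias–Temam's Lemma 2.1 mechanism; the truncated form is the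
tree's `exp_mul_min_le_mul`. [cite: FoiasTemam1989, Lemma 2.1] -/
theorem exp_mul_sqrt_freqNormSq_le_mul {ψ : ℝ} (hψ : 0 ≤ ψ) (k l : d → ℤ) :
    Real.exp (ψ * Real.sqrt (freqNormSq k)) ≤
      Real.exp (ψ * Real.sqrt (freqNormSq (k - l))) * Real.exp (ψ * Real.sqrt (freqNormSq l)) := by
  rw [← Real.exp_add, Real.exp_le_exp, ← mul_add]
  refine mul_le_mul_of_nonneg_left ?_ hψ
  have h := sqrt_freqNormSq_add_le (k - l) l
  rwa [sub_add_cancel] at h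

/-- **The Gevrey–Wiener class is an algebra**: for `ψ ≥ 0` and nonnegative `[0,∞]`-valued families
`α, β` on `ℤ^d`, `∑_k e^{ψ|k|} ∑_l α(k−l) β(l) ≤ (∑_k e^{ψ|k|} α(k)) · (∑_l e^{ψ|l|} β(l))`
(weighted Young with the submultiplicative weight `e^{ψ|k|}`). Applied to `α = ‖û‖`, `β = ‖v̂‖` it is the
product estimate `‖uv‖_{G_ψ} ≤ ‖u‖_{G_ψ}‖v‖_{G_ψ}` of the analytic Wiener norm — a bound for PRODUCTS, with
constant `1` and no gain; a derivative (as in `(u·∇)v`) is NOT absorbed by it.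
[cite: FoiasTemam1989, Lemma 2.1] [cite: Katznelson2004, Ch. I §6] -/
theorem tsum_exp_mul_conv_le {ψ : ℝ} (hψ : 0 ≤ ψ) (α β : (d → ℤ) → ℝ≥0∞) :
    ∑' k, ENNReal.ofReal (Real.exp (ψ * Real.sqrt (freqNormSq k))) * ∑' l, α (k - l) * β l ≤
      (∑' k, ENNReal.ofReal (Real.exp (ψ * Real.sqrt (freqNormSq k))) * α k) *
        ∑' l, ENNReal.ofReal (Real.exp (ψ * Real.sqrt (freqNormSq l))) * β l := by
  refine Lattice.tsum_weight_mul_conv_le _ α β fun k l => ?_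
  rw [← ENNReal.ofReal_mul (Real.exp_nonneg _)]
  exact ENNReal.ofReal_le_ofReal (exp_mul_sqrt_freqNormSq_le_mul hψ k l)

end NSGevrey

end Literature.Analysis.FluidPDE

end
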